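import Summits.ValiantsHypothesis.ValiantsHypothesis.Theorems.DefinabilityGapLowDegreeRung
import HarnessLib

/-!
# DefinabilityGap — the LEX-CERTIFICATE criterion for the planted Kabanets–Impagliazzo permanent design (unconditional)

Route `route-ValiantsHypothesis-DefinabilityGap` (decomp-valiant cycle 1, lens 5, gen 5), supporting the hitting item
`KIPlantedHitting` (stmt-ValiantsHypothesis-23547) through its size road R_K1.1 («every `2q(m)+1` block permanents
`P_c = per_m(y|S_c)` are algebraically independent, eventually in `m`»).

THE CRITERION. Rank the seed cells `𝔽_q × 𝔽_q` injectively into any linear order `τ` (`π`, most significant = `π`-least)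
and let `d_c^π` be the lex-leading exponent of `P_c` — a permutation pattern of the block `S_c` (the GREEDY diagonal:
scan the `m²` cells of the block in `π`-order and keep a cell whenever its row and column are still free). Then

* `kiPer_hits_of_injOn`: if `e ↦ Σ_c e_c • d_c^π` is injective on a set `S` of exponents, NO nonzero `D` supported on `S`
  annihilates `G_m` (the low-degree rung `kiPer_hits_lowDegree` is the case `S = {|e| ≤ k}`, `2k < m`, `π = finProdFinEquiv`);
* `kiPer_algebraicIndependent_of_linearIndependent`: if the `0/1` vectors `d_c^π` (`c ∈ T`) are `ℚ`-linearly independent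
  then `(P_c)_{c ∈ T}` is algebraically independent over `ℂ` — a RANKING CERTIFICATE for `T`;
* `leadExpR_topCell`: the `π`-top cell of a block always lies on its leading diagonal; hence
* `kiPer_algebraicIndependent_of_ranking` (PEELING RUNG, size-free): if cells `x_c ∈ S_c` (`c ∈ T`) and an injective
  height `h` on cells are given with `x_c` the `h`-highest cell of `S_c` and `h(x_c) < h(x_{c'})` whenever `x_c ∈ S_{c'}`
  (`c' ≠ c`), then `(P_c)_{c ∈ T}` is algebraically independent. Every PEELABLE family (repeatedly remove a curve owning a
  cell on no other remaining curve) carries such data (`h(x_{c_i}) = N − i`), so this strictly contains the private-cell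
  rung `2(|T|−1) < m²` of `DefinabilityGapSupportRung` and has no size hypothesis at all.

Why it matters for R_K1.1 (lens-5 g5 instrument `v5/instrument-lexcert.md`): peeling alone cannot pass `|T| ≈ m²/2`
(two translation classes of the design form a `2q`-family in which every cell lies on exactly two curves), but ranking
certificates do: at `m = 3, 4, 5` every tested family with `|T| ≤ 2q+1` — translation-class pairs, triples, pencils,
2-point bundles and random families, > 480 in all — is certified by a random ranking (success rate per ranking ≥ 19/20),
while every FIXED ranking has 4-circuits. R_K1.1 is thereby reduced to a finite 0/1-linear-algebra statement about greedy
transversals of the parabola design (`KILexCertifiable`, lens file v5). 0 sorry.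
-/

noncomputable section

open MvPolynomial
open Literature.Computability.AlgebraicComplexity Literature.Computability.MetaComplexity
open Summit.ValiantsHypothesis.ValiantsHypothesis.Theorems.DefinabilityGapAffineRung

namespace Summit.ValiantsHypothesis.ValiantsHypothesis.Theorems.DefinabilityGapLexCertificate

variable {τ : Type*} [LinearOrder τ] [WellFoundedGT τ]

/-! ## 1. The generator transported along an injective ranking of the seed cells -/

/-- The lexicographic monomial order on ranked variables (most significant variable = least element of `τ`). [this file] -/
def lexOrdR (τ : Type*) [LinearOrder τ] [WellFoundedGT τ] : MonomialOrder τ := MonomialOrder.lex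

/-- `G_m(c)` with the seed cells renamed along a ranking `π`. [this file] -/
def kiPerR (m : ℕ) (π : (Fin (qOf m) × Fin (qOf m)) → τ) (c : Fin 3 → Fin (qOf m)) : MvPolynomial τ ℂ :=
  rename π (kiPer m c)

omit [LinearOrder τ] [WellFoundedGT τ] in
/-- The ranked coordinate is `per_m` renamed along `π ∘ cellEmb`. [this file] -/
theorem kiPerR_eq (m : ℕ) (π : (Fin (qOf m) × Fin (qOf m)) → τ) (c : Fin 3 → Fin (qOf m)) :
    kiPerR m π c = rename (π ∘ (cellEmb m c)) (perPoly (Fin m) ℂ) := by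
  rw [kiPerR, kiPer_eq_rename_cellEmb, rename_rename]

omit [LinearOrder τ] [WellFoundedGT τ] in
/-- The ranked coordinate is nonzero. [this file] -/
theorem kiPerR_ne_zero (m : ℕ) {π : (Fin (qOf m) × Fin (qOf m)) → τ} (hπ : Function.Injective π)
    (c : Fin 3 → Fin (qOf m)) : kiPerR m π c ≠ 0 := fun h =>
  kiPer_ne_zero m c (rename_injective _ hπ (by rw [map_zero]; exact h))

/-- The lex-leading exponent `d_c^π` of the ranked coordinate (the greedy diagonal of the block `S_c`). [this file] -/
def leadExpR (m : ℕ) (π : (Fin (qOf m) × Fin (qOf m)) → τ) (c : Fin 3 → Fin (qOf m)) : τ →₀ ℕ :=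
  (lexOrdR τ).degree (kiPerR m π c)

/-- `d_c^π` is a ranked permutation pattern. [this file] -/
theorem exists_leadExpR_eq (m : ℕ) {π : (Fin (qOf m) × Fin (qOf m)) → τ} (hπ : Function.Injective π)
    (c : Fin 3 → Fin (qOf m)) : ∃ ρ : Equiv.Perm (Fin m),
    leadExpR m π c = Finsupp.mapDomain (π ∘ (cellEmb m c)) (permMonomial ρ) := by
  have hmem : leadExpR m π c ∈ (kiPerR m π c).support := (lexOrdR τ).degree_mem_support (kiPerR_ne_zero m hπ c)
  rw [mem_support_iff, kiPerR_eq] at hmem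
  obtain ⟨u, hu, hc⟩ := coeff_rename_ne_zero _ _ _ hmem
  obtain ⟨ρ, rfl⟩ := exists_permMonomial_eq_of_coeff_perPoly_ne_zero ℂ hc
  exact ⟨ρ, hu.symm⟩

/-- `d_c^π` is `0/1`-valued. [this file] -/
theorem leadExpR_apply_le_one (m : ℕ) {π : (Fin (qOf m) × Fin (qOf m)) → τ} (hπ : Function.Injective π)
    (c : Fin 3 → Fin (qOf m)) (x : τ) : leadExpR m π c x ≤ 1 := by
  obtain ⟨ρ, h⟩ := exists_leadExpR_eq m hπ c
  rw [h]
  exact mapDomain_permMonomial_apply_le_one (hπ.comp (cellEmb m c).injective) ρ x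

/-- `d_c^π` lives inside the ranked block of `c`. [this file] -/
theorem support_leadExpR_subset (m : ℕ) {π : (Fin (qOf m) × Fin (qOf m)) → τ} (hπ : Function.Injective π)
    (c : Fin 3 → Fin (qOf m)) : (leadExpR m π c).support ⊆ Finset.univ.image (π ∘ (cellEmb m c)) := by
  classical
  obtain ⟨ρ, h⟩ := exists_leadExpR_eq m hπ c
  rw [h, Finsupp.mapDomain_support_of_injective (hπ.comp (cellEmb m c).injective)]
  exact Finset.image_subset_image (Finset.subset_univ _)

/-- The leading exponent of the power product `∏_c P_c^{e_c}`: `Σ_c e_c • d_c^π`. [this file] -/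
def leadSumR (m : ℕ) (π : (Fin (qOf m) × Fin (qOf m)) → τ) (e : (Fin 3 → Fin (qOf m)) →₀ ℕ) : τ →₀ ℕ :=
  e.sum fun c n => n • leadExpR m π c

omit [LinearOrder τ] [WellFoundedGT τ] in
/-- A term `a · ∏_c P_c^{e_c}` with `a ≠ 0` is nonzero. [this file] -/
theorem term_ne_zeroR (m : ℕ) {π : (Fin (qOf m) × Fin (qOf m)) → τ} (hπ : Function.Injective π)
    (e : (Fin 3 → Fin (qOf m)) →₀ ℕ) {a : ℂ} (ha : a ≠ 0) : bind₁ (kiPerR m π) (monomial e a) ≠ 0 := by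
  rw [bind₁_monomial]
  exact mul_ne_zero (C_eq_zero.not.2 ha)
    (Finset.prod_ne_zero_iff.2 fun c _ => pow_ne_zero _ (kiPerR_ne_zero m hπ c))

/-- The lex-leading exponent of the term `a · ∏_c P_c^{e_c}` is `Σ_c e_c • d_c^π`. [this file] -/
theorem degree_termR (m : ℕ) {π : (Fin (qOf m) × Fin (qOf m)) → τ} (hπ : Function.Injective π)
    (e : (Fin 3 → Fin (qOf m)) →₀ ℕ) {a : ℂ} (ha : a ≠ 0) :
    (lexOrdR τ).degree (bind₁ (kiPerR m π) (monomial e a)) = leadSumR m π e := by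
  classical
  have hprod : (∏ c ∈ e.support, kiPerR m π c ^ e c) ≠ 0 :=
    Finset.prod_ne_zero_iff.2 fun c _ => pow_ne_zero _ (kiPerR_ne_zero m hπ c)
  rw [bind₁_monomial, (lexOrdR τ).degree_mul (C_eq_zero.not.2 ha) hprod, (lexOrdR τ).degree_C, zero_add,
    (lexOrdR τ).degree_prod (fun c _ => pow_ne_zero _ (kiPerR_ne_zero m hπ c))]
  simp_rw [(lexOrdR τ).degree_pow]
  rfl

/-! ## 2. The certificate theorem: injectivity of leading sums ⟹ hitting -/

/-- Ranked form. [this file] -/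
theorem kiPerR_hits_of_injOn (m : ℕ) {π : (Fin (qOf m) × Fin (qOf m)) → τ} (hπ : Function.Injective π)
    (S : Set ((Fin 3 → Fin (qOf m)) →₀ ℕ)) (hinj : Set.InjOn (leadSumR m π) S)
    (D : MvPolynomial (Fin 3 → Fin (qOf m)) ℂ) (hD : D ≠ 0) (hS : ∀ e ∈ D.support, e ∈ S) :
    bind₁ (kiPerR m π) D ≠ 0 := by
  classical
  have hne : D.support.Nonempty := Finset.nonempty_iff_ne_empty.2 fun h => hD (support_eq_empty.1 h)
  obtain ⟨e₀, he₀, hmax⟩ := Finset.exists_max_image D.support (fun e => (lexOrdR τ).toSyn (leadSumR m π e)) hne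
  have key : coeff (leadSumR m π e₀) (bind₁ (kiPerR m π) D) =
      coeff (leadSumR m π e₀) (bind₁ (kiPerR m π) (monomial e₀ (coeff e₀ D))) := by
    conv_lhs => rw [D.as_sum, map_sum, coeff_sum]
    rw [Finset.sum_eq_single e₀]
    · intro e he hne'
      apply (lexOrdR τ).coeff_eq_zero_of_lt
      rw [degree_termR m hπ e (mem_support_iff.1 he)]
      exact lt_of_le_of_ne (hmax e he) fun h =>
        hne' (hinj (hS e he) (hS e₀ he₀) ((lexOrdR τ).toSyn.injective h))
    · intro h
      exact absurd he₀ h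
  intro h0
  rw [h0, coeff_zero] at key
  have hT0 := term_ne_zeroR m hπ e₀ (mem_support_iff.1 he₀)
  apply ((lexOrdR τ).leadingCoeff_ne_zero_iff.2 hT0)
  show coeff ((lexOrdR τ).degree _) _ = 0
  rw [degree_termR m hπ e₀ (mem_support_iff.1 he₀)]
  exact key.symm

/-- **Certificate theorem (kernel).** For every injective ranking `π` of the seed cells into a well-ordered type and every
set `S` of exponents on which `e ↦ Σ_c e_c • d_c^π` is injective, no nonzero polynomial supported on `S` annihilates the
planted generator `G_m`. [this file] -/
theorem kiPer_hits_of_injOn (m : ℕ) {π : (Fin (qOf m) × Fin (qOf m)) → τ} (hπ : Function.Injective π)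
    (S : Set ((Fin 3 → Fin (qOf m)) →₀ ℕ)) (hinj : Set.InjOn (leadSumR m π) S)
    (D : MvPolynomial (Fin 3 → Fin (qOf m)) ℂ) (hD : D ≠ 0) (hS : ∀ e ∈ D.support, e ∈ S) :
    bind₁ (kiPer m) D ≠ 0 := by
  intro h0
  apply kiPerR_hits_of_injOn m hπ S hinj D hD hS
  have h1 : bind₁ (kiPerR m π) D = rename π (bind₁ (kiPer m) D) := by
    rw [rename_bind₁]
    rfl
  rw [h1, h0, map_zero]

/-! ## 3. Linear independence of the leading diagonals ⟹ algebraic independence -/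

/-- The leading diagonal `d_c^π` as a `ℚ`-valued `0/1` vector. [this file] -/
def leadVecR (m : ℕ) (π : (Fin (qOf m) × Fin (qOf m)) → τ) (c : Fin 3 → Fin (qOf m)) : τ → ℚ :=
  fun x => (leadExpR m π c x : ℚ)

/-- Coordinates of `Σ_c e_c • d_c^π`, over `ℚ`. [this file] -/
theorem leadSumR_apply (m : ℕ) (π : (Fin (qOf m) × Fin (qOf m)) → τ) (e : (Fin 3 → Fin (qOf m)) →₀ ℕ) (x : τ) :
    ((leadSumR m π e x : ℕ) : ℚ) = ∑ c ∈ e.support, (e c : ℚ) * leadVecR m π c x := by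
  rw [leadSumR, Finsupp.sum_apply, Finsupp.sum, Nat.cast_sum]
  refine Finset.sum_congr rfl fun c _ => ?_
  rw [Finsupp.smul_apply, smul_eq_mul, Nat.cast_mul]
  rfl

/-- `ℚ`-linear independence of `(d_c^π)_{c ∈ T}` makes `e ↦ Σ_c e_c • d_c^π` injective on exponents supported in `T`.
[this file] -/
theorem injOn_of_linearIndependent (m : ℕ) (π : (Fin (qOf m) × Fin (qOf m)) → τ)
    (T : Finset (Fin 3 → Fin (qOf m)))
    (hli : LinearIndependent ℚ (fun c : T => leadVecR m π (c : Fin 3 → Fin (qOf m)))) :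
    Set.InjOn (leadSumR m π) {e | e.support ⊆ T} := by
  classical
  intro e he e' he' h
  have he1 : e.support ⊆ T := he
  have he2 : e'.support ⊆ T := he'
  have hx : ∀ x, ∑ c ∈ T, ((e c : ℚ) - e' c) * leadVecR m π c x = 0 := by
    intro x
    have h1 : ((leadSumR m π e x : ℕ) : ℚ) = ((leadSumR m π e' x : ℕ) : ℚ) := by rw [h]
    rw [leadSumR_apply, leadSumR_apply,
      Finset.sum_subset he1 (fun c _ hc => by rw [Finsupp.notMem_support_iff.1 hc]; simp),
      Finset.sum_subset he2 (fun c _ hc => by rw [Finsupp.notMem_support_iff.1 hc]; simp)] at h1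
    simp_rw [sub_mul, Finset.sum_sub_distrib, h1, sub_self]
  have hfun : ∑ c : T, ((e c : ℚ) - e' c) • leadVecR m π (c : Fin 3 → Fin (qOf m)) = 0 := by
    ext x
    rw [Finset.sum_apply, Pi.zero_apply]
    simp_rw [Pi.smul_apply, smul_eq_mul]
    rw [Finset.sum_coe_sort T (fun c => ((e c : ℚ) - e' c) * leadVecR m π c x)]
    exact hx x
  have hg := (Fintype.linearIndependent_iff.1 hli) (fun c : T => (e c : ℚ) - e' c) hfun
  ext c
  by_cases hc : c ∈ T
  · have h2 := hg ⟨c, hc⟩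
    exact_mod_cast sub_eq_zero.1 h2
  · rw [Finsupp.notMem_support_iff.1 (fun h' => hc (he1 h')), Finsupp.notMem_support_iff.1 (fun h' => hc (he2 h'))]

/-- Hitting form: a nonzero `D` whose monomials only use coordinates from a certified `T` is hit. [this file] -/
theorem kiPer_hits_of_linearIndependent (m : ℕ) {π : (Fin (qOf m) × Fin (qOf m)) → τ}
    (hπ : Function.Injective π) (T : Finset (Fin 3 → Fin (qOf m)))
    (hli : LinearIndependent ℚ (fun c : T => leadVecR m π (c : Fin 3 → Fin (qOf m))))
    (D : MvPolynomial (Fin 3 → Fin (qOf m)) ℂ) (hD : D ≠ 0) (hT : ∀ e ∈ D.support, e.support ⊆ T) :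
    bind₁ (kiPer m) D ≠ 0 :=
  kiPer_hits_of_injOn m hπ {e | e.support ⊆ T} (injOn_of_linearIndependent m π T hli) D hD hT

/-- **Ranking certificate ⟹ algebraic independence (kernel).** If, for some injective ranking `π` of the seed cells, the
lex-leading diagonals `d_c^π` (`c ∈ T`) are `ℚ`-linearly independent, then the block permanents `(P_c)_{c ∈ T}` of the
planted generator are algebraically independent over `ℂ`. [this file] -/
theorem kiPer_algebraicIndependent_of_linearIndependent (m : ℕ) {π : (Fin (qOf m) × Fin (qOf m)) → τ}
    (hπ : Function.Injective π) (T : Finset (Fin 3 → Fin (qOf m)))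
    (hli : LinearIndependent ℚ (fun c : T => leadVecR m π (c : Fin 3 → Fin (qOf m)))) :
    AlgebraicIndependent ℂ (fun c : T => kiPer m (c : Fin 3 → Fin (qOf m))) := by
  classical
  rw [algebraicIndependent_iff]
  intro p hp
  by_contra hp0
  have hD : rename ((↑) : T → (Fin 3 → Fin (qOf m))) p ≠ 0 := fun h =>
    hp0 (rename_injective _ Subtype.val_injective (by rw [h, map_zero]))
  apply kiPer_hits_of_linearIndependent m hπ T hli _ hD
  · intro e he
    rw [support_rename_of_injective Subtype.val_injective] at he
    obtain ⟨e', -, rfl⟩ := Finset.mem_image.1 he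
    rw [Finsupp.mapDomain_support_of_injective Subtype.val_injective]
    intro c hc
    obtain ⟨c', -, rfl⟩ := Finset.mem_image.1 hc
    exact c'.2
  · rw [← aeval_eq_bind₁, aeval_rename]
    exact hp

/-! ## 4. The top cell of a block lies on its leading diagonal; the peeling rung -/

/-- **Top-cell lemma.** The `π`-most-significant cell of the block `S_c` belongs to the lex-leading diagonal `d_c^π`.
[this file] -/
theorem leadExpR_topCell (m : ℕ) {π : (Fin (qOf m) × Fin (qOf m)) → τ} (hπ : Function.Injective π)
    (c : Fin 3 → Fin (qOf m)) (p₀ : Fin m × Fin m)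
    (htop : ∀ p, p ≠ p₀ → π (cellEmb m c p₀) < π (cellEmb m c p)) :
    leadExpR m π c (π (cellEmb m c p₀)) = 1 := by
  classical
  have hinj : Function.Injective (π ∘ (cellEmb m c)) := hπ.comp (cellEmb m c).injective
  obtain ⟨ρ, hρ⟩ := exists_leadExpR_eq m hπ c
  -- values below the top cell vanish for every ranked pattern of the block
  have hlow : ∀ (u : Fin m × Fin m →₀ ℕ) (j : τ), j < π (cellEmb m c p₀) →
      Finsupp.mapDomain (π ∘ (cellEmb m c)) u j = 0 := by
    intro u j hj
    apply Finsupp.mapDomain_notin_range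
    rintro ⟨p, rfl⟩
    by_cases hp : p = p₀
    · subst hp
      exact lt_irrefl _ hj
    · exact lt_asymm hj (htop p hp)
  -- the competitor: a diagonal through `p₀`
  set u : τ →₀ ℕ := Finsupp.mapDomain (π ∘ (cellEmb m c)) (permMonomial (Equiv.swap p₀.2 p₀.1)) with hu
  have hu_top : u (π (cellEmb m c p₀)) = 1 := by
    have h1 : u ((π ∘ (cellEmb m c)) p₀) = permMonomial (Equiv.swap p₀.2 p₀.1) p₀ :=
      Finsupp.mapDomain_apply hinj _ p₀
    rw [Function.comp_apply] at h1
    rw [h1]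
    obtain ⟨a, b⟩ := p₀
    rw [permMonomial_apply, if_pos (Equiv.swap_apply_left b a)]
  have hu_supp : u ∈ (kiPerR m π c).support := by
    rw [mem_support_iff, kiPerR_eq, hu, coeff_rename_mapDomain _ hinj, coeff_permMonomial_perPoly]
    exact one_ne_zero
  have hle : (lexOrdR τ).toSyn u ≤ (lexOrdR τ).toSyn (leadExpR m π c) := (lexOrdR τ).le_degree hu_supp
  have hle' : toLex u ≤ toLex (leadExpR m π c) := MonomialOrder.lex_le_iff.1 hle
  have h01 := leadExpR_apply_le_one m hπ c (π (cellEmb m c p₀))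
  by_contra hne
  have h0 : leadExpR m π c (π (cellEmb m c p₀)) = 0 := by omega
  have hlt : toLex (leadExpR m π c) < toLex u := by
    refine Finsupp.lex_def.2 ⟨π (cellEmb m c p₀), fun j hj => ?_, ?_⟩
    · show leadExpR m π c j = u j
      rw [hρ, hlow _ j hj, hu, hlow _ j hj]
    · show leadExpR m π c (π (cellEmb m c p₀)) < u (π (cellEmb m c p₀))
      rw [h0, hu_top]
      exact zero_lt_one
  exact absurd hlt (not_lt.2 hle')

/-- **Triangular criterion.** Top cells `x_c = cellEmb m c (p₀ c)` with `π(x_{c'}) < π(x_c)` whenever `x_c ∈ S_{c'}`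
(`c' ≠ c`) make the leading diagonals `(d_c^π)_{c ∈ T}` linearly independent. [this file] -/
theorem linearIndependent_leadVecR_of_topCells (m : ℕ) {π : (Fin (qOf m) × Fin (qOf m)) → τ}
    (hπ : Function.Injective π) (T : Finset (Fin 3 → Fin (qOf m)))
    (p₀ : (Fin 3 → Fin (qOf m)) → Fin m × Fin m)
    (htop : ∀ c ∈ T, ∀ p, p ≠ p₀ c → π (cellEmb m c (p₀ c)) < π (cellEmb m c p))
    (htri : ∀ c ∈ T, ∀ c' ∈ T, c' ≠ c → ∀ p, cellEmb m c' p = cellEmb m c (p₀ c) →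
      π (cellEmb m c' (p₀ c')) < π (cellEmb m c (p₀ c))) :
    LinearIndependent ℚ (fun c : T => leadVecR m π (c : Fin 3 → Fin (qOf m))) := by
  classical
  rw [Fintype.linearIndependent_iff]
  intro g hg
  by_contra hne
  obtain ⟨i₀, hi₀⟩ := not_forall.1 hne
  obtain ⟨c, hcS, hcmin⟩ := Finset.exists_min_image (Finset.univ.filter fun i : T => g i ≠ 0)
    (fun i : T => π (cellEmb m (i : Fin 3 → Fin (qOf m)) (p₀ i))) ⟨i₀, by simpa using hi₀⟩
  have hgc : g c ≠ 0 := (Finset.mem_filter.1 hcS).2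
  have hx := congr_fun hg (π (cellEmb m (c : Fin 3 → Fin (qOf m)) (p₀ c)))
  rw [Finset.sum_apply, Pi.zero_apply] at hx
  simp_rw [Pi.smul_apply, smul_eq_mul] at hx
  rw [Finset.sum_eq_single c] at hx
  · have h1 := leadExpR_topCell m hπ (c : Fin 3 → Fin (qOf m)) (p₀ c) (htop c c.2)
    simp only [leadVecR, h1, Nat.cast_one, mul_one] at hx
    exact hgc hx
  · intro c' _ hc'c
    by_cases hg' : g c' = 0
    · rw [hg', zero_mul]
    · have h0 : leadExpR m π (c' : Fin 3 → Fin (qOf m)) (π (cellEmb m (c : Fin 3 → Fin (qOf m)) (p₀ c))) = 0 := by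
        by_contra h1
        have hmem := support_leadExpR_subset m hπ (c' : Fin 3 → Fin (qOf m)) (Finsupp.mem_support_iff.2 h1)
        obtain ⟨p, -, hp⟩ := Finset.mem_image.1 hmem
        have hp' : cellEmb m (c' : Fin 3 → Fin (qOf m)) p = cellEmb m (c : Fin 3 → Fin (qOf m)) (p₀ c) := hπ hp
        have hlt := htri c c.2 c' c'.2 (fun h => hc'c (Subtype.ext h)) p hp'
        exact (not_lt.2 (hcmin c' (by simpa using hg'))) hlt
      simp only [leadVecR, h0, Nat.cast_zero, mul_zero]
  · intro h
    exact absurd (Finset.mem_univ c) h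

/-- **Ranking criterion ⟹ algebraic independence (ranked form).** [this file] -/
theorem kiPer_algebraicIndependent_of_topCells (m : ℕ) {π : (Fin (qOf m) × Fin (qOf m)) → τ}
    (hπ : Function.Injective π) (T : Finset (Fin 3 → Fin (qOf m)))
    (p₀ : (Fin 3 → Fin (qOf m)) → Fin m × Fin m)
    (htop : ∀ c ∈ T, ∀ p, p ≠ p₀ c → π (cellEmb m c (p₀ c)) < π (cellEmb m c p))
    (htri : ∀ c ∈ T, ∀ c' ∈ T, c' ≠ c → ∀ p, cellEmb m c' p = cellEmb m c (p₀ c) →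
      π (cellEmb m c' (p₀ c')) < π (cellEmb m c (p₀ c))) :
    AlgebraicIndependent ℂ (fun c : T => kiPer m (c : Fin 3 → Fin (qOf m))) :=
  kiPer_algebraicIndependent_of_linearIndependent m hπ T
    (linearIndependent_leadVecR_of_topCells m hπ T p₀ htop htri)

/-- **The peeling rung (unconditional, size-free, kernel).** Give every coordinate `c ∈ T` a cell `x_c = cellEmb m c (p₀ c)`
of its block and the seed cells an injective HEIGHT `h : 𝔽_q × 𝔽_q → ℕ` such that `x_c` is the highest cell of `S_c` and
`h(x_c) < h(x_{c'})` whenever `x_c` also lies in `S_{c'}` (`c' ∈ T`, `c' ≠ c`). Then the block permanents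
`(per_m(y|S_c))_{c ∈ T}` are algebraically independent over `ℂ`. A peeling order `c₁, …, c_t` of `T` (the cell `x_{c_i}`
lies on no `c_j`, `j > i`) yields such data with `h(x_{c_i}) = q² + t − i` and `h = finProdFinEquiv` elsewhere; the
private-cell rung `2(t−1) < m²` (`DefinabilityGapSupportRung.kiPer_algebraicIndependent`) is the case where every
sub-family has a private cell. [this file] -/
theorem kiPer_algebraicIndependent_of_ranking (m : ℕ) (T : Finset (Fin 3 → Fin (qOf m)))
    (h : (Fin (qOf m) × Fin (qOf m)) → ℕ) (hh : Function.Injective h)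
    (p₀ : (Fin 3 → Fin (qOf m)) → Fin m × Fin m)
    (htop : ∀ c ∈ T, ∀ p, p ≠ p₀ c → h (cellEmb m c p) < h (cellEmb m c (p₀ c)))
    (htri : ∀ c ∈ T, ∀ c' ∈ T, c' ≠ c → ∀ p, cellEmb m c' p = cellEmb m c (p₀ c) →
      h (cellEmb m c (p₀ c)) < h (cellEmb m c' (p₀ c'))) :
    AlgebraicIndependent ℂ (fun c : T => kiPer m (c : Fin 3 → Fin (qOf m))) :=
  kiPer_algebraicIndependent_of_topCells (τ := ℕᵒᵈ) m (π := OrderDual.toDual ∘ h)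
    (OrderDual.toDual.injective.comp hh) T p₀
    (fun c hc p hp => OrderDual.toDual_lt_toDual.2 (htop c hc p hp))
    (fun c hc c' hc' hne p hp => OrderDual.toDual_lt_toDual.2 (htri c hc c' hc' hne p hp))

end Summit.ValiantsHypothesis.ValiantsHypothesis.Theorems.DefinabilityGapLexCertificate

end
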